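import Summits.AtomisticToContinuum.Crystallization.Theorems.PerronTransitivityUniformBindingRigidityCohesionI

/-!
# Cohesion of uniformly bound Lennard-Jones configurations, XII: `(LOCAL)` from a finite certificate

Helper file (`--supports stmt-AtomisticToContinuum-15099`) of the registered stub
`stub_localHalfSpaceCert` (= `(LOCAL)`) of the line `registered` of the crux
`Summit.AtomisticToContinuum.Crystallization.Theses.PerronTransitivity.UniformBindingRigidity`
(item stmt-AtomisticToContinuum-15099).  In the notation
`U_Y(p) = Σ'_{q ∈ Y, q ≠ p} V_LJ(dist p q)`, `V_LJ(r) = r⁻¹²/12 − r⁻⁶/6`, the stub `(LOCAL)` says: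
in a `9/20`-separated `Y ∋ 0` contained in a closed half-space `{⟪·, u⟫ ≤ 0}` through its top site
`0`, SOME site `p ∈ Y` with `dist p 0 ≤ 6` has `U_Y(p) > −711/500`.

This file isolates what a (computer-assisted) certificate must verify: a statement `FINCERT(R')`
about FINITE clusters only,

  `FINCERT(R')`: for every finite `9/20`-separated `F ∋ 0`, `F ⊆ {⟪·, u⟫ ≤ 0} ∩ closedBall 0 (6 + R')`
  (`‖u‖ = 1`), some `p ∈ F` with `dist p 0 ≤ 6` has TRUNCATED cluster sum
  `Σ_{q ∈ F, q ≠ p, dist q p ≤ R'} V_LJ(dist p q) > −711/500 + τ(R')`,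

where `τ(R') = (1/6)·1024/((9/20)³ R'³)` is the landed far-tail allowance of a site sum of a
`9/20`-separated set beyond radius `R'` (part IX, `sum_near_sub_tail_le_tsum`).

* §22 `local_of_finiteCert_of_tail` — the reduction for an ABSTRACT tail allowance `τ` at radius
  `R' ≥ 0` (any lower truncation estimate `Σ_{near} V_LJ − τ ≤ U_Y(p)` valid for all
  `9/20`-separated `Y`), so that sharper tail constants plug in unchanged; and the registered
  sub-goal `stub_local_of_finiteCert : (∃ R' ≥ 1, FINCERT(R')) → (LOCAL)` verbatim.
  Proof: given `Y`, the cluster `F = Y ∩ closedBall 0 (6 + R')` is finite (`finite_sep_ball`),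
  `FINCERT` yields `p ∈ F`, `dist p 0 ≤ 6`; every `q ∈ Y ∖ {p}` with `dist q p ≤ R'` has
  `dist q 0 ≤ 6 + R'`, so the near set of `p` in `Y` IS the near set of `p` in `F`, and
  `U_Y(p) ≥ Σ_{near} V_LJ − τ(R') > −711/500`, contradicting the hypothesis of `(LOCAL)` at `p`.

Remarks. (i) `FINCERT(R')` for SOME `R' ≥ 1` is also NECESSARY for `(LOCAL)` up to the margin:
`(LOCAL)` applied to the finite set `Y := F` gives a site with full cluster sum `> −711/500`, the
terms beyond `R' ≥ 1` are `≤ 0`, and a uniform positive margin follows from the sequential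
compactness of the half-space-bound class (part X); so the reduction loses nothing but the size of
`R'`.  (ii) With the tail constant `1024`, `τ(R') < 711/500` needs `R' ≥ 11`; the sharp tail of
part XIII lowers the admissible radius.  All `[folklore]`.
-/

noncomputable section

namespace Summit.AtomisticToContinuum.Crystallization.Theorems.PerronTransitivityUniformBindingRigidity

open scoped BigOperators Topology
open Filter Set Metric
open Literature.MathematicalPhysics.StatisticalMechanics
open Summit.AtomisticToContinuum.Crystallization.Theorems.ChargedEnergyGapNegative (E3)

/-! ## §22 The finite-certificate reduction of `(LOCAL)` -/

/-- **`(LOCAL)` from a finite certificate, abstract tail.** Let `R' ≥ 0` and let `τ` be a lower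
truncation allowance at radius `R'` for `9/20`-separated sets: `Σ_{q ∈ N} V_LJ(dist p q) − τ ≤ U_Y(p)`
for every `9/20`-separated `Y`, every centre `p` and the near set
`N = {q ∈ Y ∖ {p} : dist q p ≤ R'}`.  If every finite `9/20`-separated half-space cluster
`F ∋ 0` within `6 + R'` of `0` has a site `p`, `dist p 0 ≤ 6`, whose truncated cluster sum exceeds
`−711/500 + τ`, then `(LOCAL)` holds: for `Y` as in `(LOCAL)` take `F = Y ∩ closedBall 0 (6 + R')`
(finite, `finite_sep_ball`); the near set of the certified site `p` in `Y` is its near set in `F`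
(`dist q 0 ≤ dist q p + dist p 0 ≤ R' + 6`), so `U_Y(p) > −711/500`. [folklore] -/
theorem local_of_finiteCert_of_tail {R' τ : ℝ} (hR' : 0 ≤ R')
    (htail : ∀ Y : Set E3, (∀ a ∈ Y, ∀ b ∈ Y, a ≠ b → 9 / 20 ≤ dist a b) →
      ∀ (p : E3) (N : Finset E3), (∀ q, q ∈ N ↔ q ∈ Y ∧ q ≠ p ∧ dist q p ≤ R') →
        ∑ q ∈ N, lennardJones (dist p q) - τ ≤
          ∑' q : {q : E3 // q ∈ Y ∧ q ≠ p}, lennardJones (dist p q.1))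
    (hcert : ∀ (F : Finset E3) (u : E3), ‖u‖ = 1 → (0 : E3) ∈ F →
      (∀ a ∈ F, ∀ b ∈ F, a ≠ b → 9 / 20 ≤ dist a b) → (∀ a ∈ F, inner ℝ a u ≤ 0) →
      (∀ a ∈ F, dist a 0 ≤ 6 + R') →
      ∃ p ∈ F, dist p 0 ≤ 6 ∧ ∀ N : Finset E3,
        (∀ q, q ∈ N ↔ q ∈ F ∧ q ≠ p ∧ dist q p ≤ R') →
          -(711 / 500) + τ < ∑ q ∈ N, lennardJones (dist p q))
    (Y : Set E3) (u : E3) (hu : ‖u‖ = 1) (h0 : (0 : E3) ∈ Y)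
    (hsep : ∀ p ∈ Y, ∀ q ∈ Y, p ≠ q → 9 / 20 ≤ dist p q) (hhalf : ∀ q ∈ Y, inner ℝ q u ≤ 0)
    (hU : ∀ p ∈ Y, dist p 0 ≤ 6 →
      ∑' q : {q : E3 // q ∈ Y ∧ q ≠ p}, lennardJones (dist p q.1) ≤ -(711 / 500)) :
    False := by
  have hδ : (0 : ℝ) < 9 / 20 := by norm_num
  -- the finite cluster `F = Y ∩ closedBall 0 (6 + R')`
  have hfin := finite_sep_ball hδ hsep (0 : E3) (6 + R')
  set F : Finset E3 := hfin.toFinset with hFdef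
  have hF : ∀ z, z ∈ F ↔ z ∈ Y ∧ dist z 0 ≤ 6 + R' := fun z => by
    rw [hFdef, Set.Finite.mem_toFinset]; rfl
  have h0F : (0 : E3) ∈ F := (hF 0).2 ⟨h0, by rw [dist_self]; linarith⟩
  obtain ⟨p, hpF, hp6, hcertp⟩ := hcert F u hu h0F
    (fun a ha b hb hab => hsep a ((hF a).1 ha).1 b ((hF b).1 hb).1 hab)
    (fun a ha => hhalf a ((hF a).1 ha).1) (fun a ha => ((hF a).1 ha).2)
  have hp : p ∈ Y := ((hF p).1 hpF).1
  -- the near set of `p` in `Y` is its near set in `F`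
  obtain ⟨N, hN⟩ := exists_finset_near hδ hsep p R'
  have hN' : ∀ q, q ∈ N ↔ q ∈ F ∧ q ≠ p ∧ dist q p ≤ R' := by
    intro q
    rw [hN, hF]
    constructor
    · rintro ⟨hq, hqp, hd⟩
      exact ⟨⟨hq, by linarith [dist_triangle q p 0]⟩, hqp, hd⟩
    · rintro ⟨⟨hq, -⟩, hqp, hd⟩
      exact ⟨hq, hqp, hd⟩
  have h1 := htail Y hsep p N hN
  have h2 := hcertp N hN'
  have h3 := hU p hp hp6
  linarith

/-! ## Registered sub-goal of `stub_localHalfSpaceCert`: the finite-certificate reduction -/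

/-- **Sub-goal `stub_local_of_finiteCert` of the stub `stub_localHalfSpaceCert`** (registered on
stmt-AtomisticToContinuum-15099): `(∃ R' ≥ 1, FINCERT(R')) → (LOCAL)` with the landed tail
allowance `τ(R') = (1/6)·1024/((9/20)³ R'³)` (`local_of_finiteCert_of_tail` with part IX's
`sum_near_sub_tail_le_tsum` at `δ = 9/20 ≤ R'`).  `FINCERT(R')`: every finite `9/20`-separated
`F ∋ 0` in `{⟪·, u⟫ ≤ 0} ∩ closedBall 0 (6 + R')` (`‖u‖ = 1`) has a site `p`, `dist p 0 ≤ 6`, with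
`−711/500 + τ(R') < Σ_{q ∈ F, q ≠ p, dist q p ≤ R'} V_LJ(dist p q)` (the near set is passed as any
`Finset` `N` with the stated membership). [folklore] -/
theorem stub_local_of_finiteCert :
    (∃ R' : ℝ, 1 ≤ R' ∧
      ∀ (F : Finset (EuclideanSpace ℝ (Fin 3))) (u : EuclideanSpace ℝ (Fin 3)), ‖u‖ = 1 →
        (0 : EuclideanSpace ℝ (Fin 3)) ∈ F →
        (∀ a ∈ F, ∀ b ∈ F, a ≠ b → 9 / 20 ≤ dist a b) →
        (∀ a ∈ F, inner ℝ a u ≤ 0) →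
        (∀ a ∈ F, dist a 0 ≤ 6 + R') →
        ∃ p ∈ F, dist p 0 ≤ 6 ∧
          ∀ N : Finset (EuclideanSpace ℝ (Fin 3)),
            (∀ q, q ∈ N ↔ q ∈ F ∧ q ≠ p ∧ dist q p ≤ R') →
            -(711 / 500) + 1 / 6 * (1024 / ((9 / 20) ^ 3 * R' ^ 3)) <
              ∑ q ∈ N, lennardJones (dist p q)) →
    ∀ (Y : Set (EuclideanSpace ℝ (Fin 3))) (u : EuclideanSpace ℝ (Fin 3)), ‖u‖ = 1 →
      (0 : EuclideanSpace ℝ (Fin 3)) ∈ Y →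
      (∀ p ∈ Y, ∀ q ∈ Y, p ≠ q → 9 / 20 ≤ dist p q) →
      (∀ q ∈ Y, inner ℝ q u ≤ 0) →
      (∀ p ∈ Y, dist p 0 ≤ 6 → ∑' q : {q : EuclideanSpace ℝ (Fin 3) // q ∈ Y ∧ q ≠ p},
          lennardJones (dist p q.1) ≤ -(711 / 500)) →
      False := by
  rintro ⟨R', hR', hcert⟩ Y u hu h0 hsep hhalf hU
  have hδ : (0 : ℝ) < 9 / 20 := by norm_num
  exact local_of_finiteCert_of_tail (τ := 1 / 6 * (1024 / ((9 / 20 : ℝ) ^ 3 * R' ^ 3)))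
    (by linarith) (fun Y' hsep' p N hN => sum_near_sub_tail_le_tsum hδ hsep' p (by linarith) N hN)
    hcert Y u hu h0 hsep hhalf hU

end Summit.AtomisticToContinuum.Crystallization.Theorems.PerronTransitivityUniformBindingRigidity

end
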